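import Summits.QuantumFields.BalabanUV.T4Continuum.Support.GaugeTermCoercivity
import Literature.MathematicalPhysics.QuantumFieldTheory.Balaban1983to89.Beta.DeltaACombesThomas

/-!
# T⁴ programme, SUBSTRATE (shared lattice-gauge analysis library) — THE WEIGHTED-SOLUTION FORM OF THE COMBES–THOMAS CONJUGATION
# (generic, complex Hermitian kernels with pairwise `cosh` row defects): `(γ − J)·‖e^{κρ}A⁻¹v‖ ≤ ‖e^{κρ}v‖`, `Re⟨z, Az⟩ ≤ γ/(γ − J)²·‖e^{κρ}v‖²`,
# and for a Gram-plus-positive `A = XᴴX + Y`: `‖X·e^{κρ}A⁻¹v‖² ≤ γ/(γ − J)²·‖e^{κρ}v‖²` (file A of the gradient half of the decay chain)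

Substrate cell `b2b-balaban-substrate-*`, seat p3; gradient half of the chain «level-free decay of the covariant scalar averaged Green function»
(`ScalarCovariantCoercive` p217284 → `ScalarCovariantCTDefects` → `ScalarCovariantGreenDecay`; then `ScalarCovariantCTWeighted` → `ScalarCovariantGradComm`
→ `ScalarCovariantGreenGradDecay`).  Files 1–3 give, for `S_U = scalarOp n M a′ R T = D_RᴴD_R + a′n^dQ′(U)ᴴQ′(U)` on `Tor (fine n M) × o`, the
coercivity `γ_U = gammaU d a′ α τ`, the level-free row-defect budget `Jcov` and the decay of the ENTRIES of `S_U⁻¹` ([B9] =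
[Balaban1985BackgroundPropagators] Thm 3.1 (3.42) p.397, FIRST entry, ℓ²-pairing shadow).  The rows also consume the DERIVATIVE entries
«|(∇_UG′(U)λ)(x)|, |(G′(U)∇*_Uλ)(x)| ≤ B₀(L^jη)e^{−δ₀d(y,y′)}|λ|» (same display; NE3's reading `hT31` item 1 is open even at `U = 1` — header of
`Support/SliceFlatGaugeDecay`); the gradient half proves their level-free ℓ²-pairing shadows for the one-region model.

THIS FILE (generic; `A : Matrix ι ι ℂ` Hermitian, `Coercive γ A`, row defects `Beta.DeltaACombesThomas.ctRowDefect A κ ρ ≤ J`):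
 * the exponential rescaling **`wvec κ ρ x = e^{κρ}·x`** with `wvec_wvec_neg`, the pairing identity `dotProduct_wvec` (`⟨u, y⟩ = ⟨e^{−κρ}u, e^{κρ}y⟩`),
   the support bounds `nsq_wvec_le_of_nonpos` (`‖e^{κρ}v‖ ≤ ‖v‖` on `{ρ ≤ 0}`), `nsq_wvec_neg_le_of_le` ∕ `sqrt_nsq_wvec_neg_le`
   (`‖e^{−κρ}u‖ ≤ e^{−κR′}‖u‖` on `{ρ ≥ R′}`);
 * the conjugated equation `conj_form_eq_dot` and the TWO-SIDED defect bound **`re_form_le_conj_add`** (`Re⟨z,Az⟩ ≤ Re(conjugated form) + J‖z‖²`,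
   companion of `Beta.DeltaACombesThomas.conjugated_form_coercive`, same AM–GM on the symmetric weights);
 * **`weighted_solution_bound`** (`(γ − J)·‖e^{κρ}x‖ ≤ ‖e^{κρ}v‖` for `Ax = v` — the engine of `combesThomas_pairwise`, stated on its own),
   **`weighted_form_bound`** (`Re⟨z, Az⟩ ≤ γ/(γ − J)²·‖e^{κρ}v‖²`, `z = e^{κρ}x`), **`weighted_gram_bound`** (for `A = XᴴX + Y`, `Y ⪰ 0`:
   `‖Xz‖² ≤ γ/(γ − J)²·‖e^{κρ}v‖²`, via `GaugeTermResolventBounds.nsq_le_re_form`), and the adjoint pairing identity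
   `star_dotProduct_conjTranspose_mulVec` (`⟨u, Mᴴv⟩ = conj⟨v, Mu⟩`).

HONEST FRAMING (T4-DAG p. 1).  MODEL level: one region, global small field, ℓ²-pairing ∕ entry norms (no sup∕Hölder norms, no second
derivatives `Δ_UG′`), route = Combes–Thomas (OURS); constants OURS and crude.  NOT [B9] Thm 3.1 as printed; nothing printed is a hypothesis;
no `def … : Prop` fact; spine 0/9 unchanged; NOT infinite volume ∕ mass gap ∕ Clay.  HONEST DEPENDENCY: continuum YM on T⁴ ⇐ BetaPertH ∧
nine spine estimates (0/9 proved); BetaPertH ⇐ (D1) ∧ (D4) ∧ CAP+tail; G-an2-4 gates asym, D1 and NE2/3/4.  ABSOLUTE RULE kept; no `sorry`.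
-/

noncomputable section

open scoped BigOperators ComplexConjugate Matrix Matrix.Norms.L2Operator Kronecker ComplexOrder

namespace Summit.QuantumFields.BalabanUV.T4Continuum.ScalarCovariantCTWeighted

open Literature.MathematicalPhysics.QuantumFieldTheory.Balaban1983to89.B5Prop11Lower (nsq nsq_nonneg norm_star_dotProduct_le)
open Literature.MathematicalPhysics.QuantumFieldTheory.Balaban1983to89.Beta.DeltaACombesThomas (ctWeight ctRowDefect ctWeight_nonneg ctWeight_symm
  re_conjugated_form conjugated_form_coercive)
open Summit.QuantumFields.BalabanUV.T4Continuum
open Summit.QuantumFields.BalabanUV.T4Continuum.CoerciveInverseTower (Coercive)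
open Summit.QuantumFields.BalabanUV.T4Continuum.GaugeTermResolventBounds (nsq_le_re_form)

section Generic

variable {ι : Type*} [Fintype ι] [DecidableEq ι]

/-- the exponential rescaling `(e^{κρ}·x)_e = e^{κρ_e}x_e`. [folklore] -/
def wvec (κ : ℝ) (ρ : ι → ℝ) (x : ι → ℂ) : ι → ℂ := fun e => ((Real.exp (κ * ρ e) : ℝ) : ℂ) * x e

omit [Fintype ι] [DecidableEq ι] in
/-- `e^{κρ}·(e^{−κρ}·x) = x`. [folklore] -/
theorem wvec_wvec_neg (κ : ℝ) (ρ : ι → ℝ) (x : ι → ℂ) : wvec κ ρ (wvec (-κ) ρ x) = x := by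
  funext e
  simp only [wvec]
  rw [← mul_assoc, ← Complex.ofReal_mul, ← Real.exp_add, show κ * ρ e + -κ * ρ e = 0 by ring, Real.exp_zero, Complex.ofReal_one, one_mul]

omit [DecidableEq ι] in
/-- the pairing is invariant under opposite rescalings: `⟨u, y⟩ = ⟨e^{−κρ}u, e^{κρ}y⟩`. [folklore] -/
theorem dotProduct_wvec (κ : ℝ) (ρ : ι → ℝ) (u y : ι → ℂ) : star u ⬝ᵥ y = star (wvec (-κ) ρ u) ⬝ᵥ wvec κ ρ y := by
  rw [dotProduct, dotProduct]
  refine Finset.sum_congr rfl fun e _ => ?_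
  simp only [wvec, Pi.star_apply, star_mul', Complex.star_def, Complex.conj_ofReal]
  rw [show (starRingEnd ℂ) (u e) * y e = (starRingEnd ℂ) (u e) * (1 * y e) by rw [one_mul], ← Complex.ofReal_one, ← Real.exp_zero,
    show (0 : ℝ) = -κ * ρ e + κ * ρ e by ring, Real.exp_add, Complex.ofReal_mul]
  ring

omit [DecidableEq ι] in
/-- on the support of `v ⊆ {ρ ≤ 0}` the rescaling with `κ ≥ 0` does not increase the norm. [folklore] -/
theorem nsq_wvec_le_of_nonpos {κ : ℝ} (hκ : 0 ≤ κ) {ρ : ι → ℝ} {v : ι → ℂ} (hv : ∀ e, v e ≠ 0 → ρ e ≤ 0) :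
    nsq (wvec κ ρ v) ≤ nsq v := by
  unfold nsq
  refine Finset.sum_le_sum fun e _ => ?_
  simp only [wvec]
  by_cases hve : v e = 0
  · simp [hve]
  · have h1 : Real.exp (κ * ρ e) ≤ 1 := Real.exp_le_one_iff.mpr (mul_nonpos_of_nonneg_of_nonpos hκ (hv e hve))
    rw [norm_mul, Complex.norm_real, Real.norm_of_nonneg (Real.exp_pos _).le, mul_pow]
    calc Real.exp (κ * ρ e) ^ 2 * ‖v e‖ ^ 2 ≤ 1 ^ 2 * ‖v e‖ ^ 2 := by gcongr
      _ = ‖v e‖ ^ 2 := by ring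

omit [DecidableEq ι] in
/-- on the support of `u ⊆ {R′ ≤ ρ}` the opposite rescaling gains `e^{−κR′}`. [folklore] -/
theorem nsq_wvec_neg_le_of_le {κ R' : ℝ} (hκ : 0 ≤ κ) {ρ : ι → ℝ} {u : ι → ℂ} (hu : ∀ e, u e ≠ 0 → R' ≤ ρ e) :
    nsq (wvec (-κ) ρ u) ≤ Real.exp (-(κ * R')) ^ 2 * nsq u := by
  unfold nsq
  rw [Finset.mul_sum]
  refine Finset.sum_le_sum fun e _ => ?_
  simp only [wvec]
  by_cases hue : u e = 0
  · simp [hue]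
  · have h1 : Real.exp (-κ * ρ e) ≤ Real.exp (-(κ * R')) := Real.exp_le_exp.mpr (by nlinarith [hu e hue])
    rw [norm_mul, Complex.norm_real, Real.norm_of_nonneg (Real.exp_pos _).le, mul_pow]
    exact mul_le_mul_of_nonneg_right (pow_le_pow_left₀ (Real.exp_pos _).le h1 2) (sq_nonneg _)

omit [DecidableEq ι] in
/-- `√nsq` of the rescaled vectors, packaged. [folklore] -/
theorem sqrt_nsq_wvec_neg_le {κ R' : ℝ} (hκ : 0 ≤ κ) {ρ : ι → ℝ} {u : ι → ℂ} (hu : ∀ e, u e ≠ 0 → R' ≤ ρ e) :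
    Real.sqrt (nsq (wvec (-κ) ρ u)) ≤ Real.exp (-(κ * R')) * Real.sqrt (nsq u) := by
  calc Real.sqrt (nsq (wvec (-κ) ρ u)) ≤ Real.sqrt (Real.exp (-(κ * R')) ^ 2 * nsq u) := Real.sqrt_le_sqrt (nsq_wvec_neg_le_of_le hκ hu)
    _ = Real.exp (-(κ * R')) * Real.sqrt (nsq u) := by rw [Real.sqrt_mul (sq_nonneg _), Real.sqrt_sq (Real.exp_pos _).le]

omit [DecidableEq ι] in
/-- the conjugated equation: if `Ax = v` then `Σ_{e′} e^{κ(ρ_e−ρ_{e′})}A(e,e′)z_{e′} = w_e` with `z = e^{κρ}x`, `w = e^{κρ}v`, so the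
conjugated quadratic form of `z` is `⟨z, w⟩`. [folklore] -/
theorem conj_form_eq_dot (A : Matrix ι ι ℂ) (κ : ℝ) (ρ : ι → ℝ) {x v : ι → ℂ} (hx : A *ᵥ x = v) :
    ∑ e, ∑ e', (starRingEnd ℂ) (wvec κ ρ x e) * ((Real.exp (κ * (ρ e - ρ e')) : ℝ) : ℂ) * A e e' * wvec κ ρ x e'
      = star (wvec κ ρ x) ⬝ᵥ wvec κ ρ v := by
  have hconj : ∀ e, ∑ e', ((Real.exp (κ * (ρ e - ρ e')) : ℝ) : ℂ) * A e e' * wvec κ ρ x e' = wvec κ ρ v e := by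
    intro e
    have hxe : ∑ e', A e e' * x e' = v e := by
      have := congr_fun hx e; simpa [Matrix.mulVec, dotProduct] using this
    have : ∀ e', ((Real.exp (κ * (ρ e - ρ e')) : ℝ) : ℂ) * A e e' * wvec κ ρ x e' = ((Real.exp (κ * ρ e) : ℝ) : ℂ) * (A e e' * x e') := by
      intro e'
      simp only [wvec]
      rw [show κ * (ρ e - ρ e') = κ * ρ e - κ * ρ e' by ring, Real.exp_sub]
      have hpos : Real.exp (κ * ρ e') ≠ 0 := (Real.exp_pos _).ne'
      push_cast
      field_simp
    simp_rw [this, ← Finset.mul_sum, hxe, wvec]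
  rw [dotProduct]
  refine Finset.sum_congr rfl fun e _ => ?_
  rw [← hconj e, Finset.mul_sum, Pi.star_apply, Complex.star_def]
  exact Finset.sum_congr rfl fun e' _ => by ring

omit [DecidableEq ι] in
/-- **TWO-SIDED DEFECT BOUND** (companion of `conjugated_form_coercive`): for a Hermitian kernel with row defects `≤ J`,
`Re⟨z, Az⟩ ≤ Re(conjugated form of z) + J·‖z‖²`. [folklore] -/
theorem re_form_le_conj_add (A : Matrix ι ι ℂ) (hA : A.IsHermitian) (κ : ℝ) (ρ : ι → ℝ) {J : ℝ} (hJ : ∀ e, ctRowDefect A κ ρ e ≤ J)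
    (z : ι → ℂ) :
    (star z ⬝ᵥ (A *ᵥ z)).re
      ≤ (∑ e, ∑ e', (starRingEnd ℂ) (z e) * ((Real.exp (κ * (ρ e - ρ e')) : ℝ) : ℂ) * A e e' * z e').re + J * nsq z := by
  rw [re_conjugated_form A hA κ ρ z]
  have hsplit : ∑ e, ∑ e', ((starRingEnd ℂ) (z e) * A e e' * z e').re * Real.cosh (κ * (ρ e - ρ e'))
      = (∑ e, ∑ e', ((starRingEnd ℂ) (z e) * A e e' * z e').re)
        + ∑ e, ∑ e', ((starRingEnd ℂ) (z e) * A e e' * z e').re * ctWeight κ ρ e e' := by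
    rw [← Finset.sum_add_distrib]
    refine Finset.sum_congr rfl fun e _ => ?_
    rw [← Finset.sum_add_distrib]
    exact Finset.sum_congr rfl fun e' _ => by rw [ctWeight]; ring
  have hform : (∑ e, ∑ e', ((starRingEnd ℂ) (z e) * A e e' * z e').re) = (star z ⬝ᵥ (A *ᵥ z)).re := by
    rw [dotProduct, Complex.re_sum]
    refine Finset.sum_congr rfl fun e _ => ?_
    rw [Matrix.mulVec, dotProduct, Finset.mul_sum, Complex.re_sum]
    exact Finset.sum_congr rfl fun e' _ => by rw [Pi.star_apply, Complex.star_def, mul_assoc]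
  -- the defect double sum is `≥ −J‖z‖²`
  have h1 : ∀ e e', -(‖z e‖ * ‖A e e'‖ * ‖z e'‖ * ctWeight κ ρ e e') ≤ ((starRingEnd ℂ) (z e) * A e e' * z e').re * ctWeight κ ρ e e' := by
    intro e e'
    have hw := ctWeight_nonneg κ ρ e e'
    have : -(‖z e‖ * ‖A e e'‖ * ‖z e'‖) ≤ ((starRingEnd ℂ) (z e) * A e e' * z e').re := by
      have h := Complex.abs_re_le_norm ((starRingEnd ℂ) (z e) * A e e' * z e')
      rw [norm_mul, norm_mul, Complex.norm_conj] at h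
      linarith [neg_abs_le ((starRingEnd ℂ) (z e) * A e e' * z e').re]
    nlinarith
  have h2 : ∑ e, ∑ e', ‖z e‖ * ‖A e e'‖ * ‖z e'‖ * ctWeight κ ρ e e' ≤ ∑ e, ‖z e‖ ^ 2 * ctRowDefect A κ ρ e := by
    have hamgm : ∑ e, ∑ e', ‖z e‖ * ‖A e e'‖ * ‖z e'‖ * ctWeight κ ρ e e'
        ≤ ∑ e, ∑ e', (‖z e‖ ^ 2 + ‖z e'‖ ^ 2) / 2 * (‖A e e'‖ * ctWeight κ ρ e e') := by
      refine Finset.sum_le_sum fun e _ => Finset.sum_le_sum fun e' _ => ?_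
      have hc : 0 ≤ ‖A e e'‖ * ctWeight κ ρ e e' := mul_nonneg (norm_nonneg _) (ctWeight_nonneg κ ρ e e')
      have : ‖z e‖ * ‖z e'‖ ≤ (‖z e‖ ^ 2 + ‖z e'‖ ^ 2) / 2 := by nlinarith [sq_nonneg (‖z e‖ - ‖z e'‖)]
      calc ‖z e‖ * ‖A e e'‖ * ‖z e'‖ * ctWeight κ ρ e e' = (‖z e‖ * ‖z e'‖) * (‖A e e'‖ * ctWeight κ ρ e e') := by ring
        _ ≤ (‖z e‖ ^ 2 + ‖z e'‖ ^ 2) / 2 * (‖A e e'‖ * ctWeight κ ρ e e') := mul_le_mul_of_nonneg_right this hc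
    have hsym : ∑ e, ∑ e', ‖z e'‖ ^ 2 / 2 * (‖A e e'‖ * ctWeight κ ρ e e') = ∑ e, ∑ e', ‖z e‖ ^ 2 / 2 * (‖A e e'‖ * ctWeight κ ρ e e') := by
      rw [Finset.sum_comm]
      refine Finset.sum_congr rfl fun e _ => Finset.sum_congr rfl fun e' _ => ?_
      rw [ctWeight_symm κ ρ e' e, show ‖A e' e‖ = ‖A e e'‖ by rw [← hA.apply e e']; simp]
    calc ∑ e, ∑ e', ‖z e‖ * ‖A e e'‖ * ‖z e'‖ * ctWeight κ ρ e e'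
        ≤ ∑ e, ∑ e', (‖z e‖ ^ 2 + ‖z e'‖ ^ 2) / 2 * (‖A e e'‖ * ctWeight κ ρ e e') := hamgm
      _ = (∑ e, ∑ e', ‖z e‖ ^ 2 / 2 * (‖A e e'‖ * ctWeight κ ρ e e')) + ∑ e, ∑ e', ‖z e'‖ ^ 2 / 2 * (‖A e e'‖ * ctWeight κ ρ e e') := by
          rw [← Finset.sum_add_distrib]
          refine Finset.sum_congr rfl fun e _ => ?_
          rw [← Finset.sum_add_distrib]
          exact Finset.sum_congr rfl fun e' _ => by ring
      _ = ∑ e, ‖z e‖ ^ 2 * ctRowDefect A κ ρ e := by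
          rw [hsym, ← Finset.sum_add_distrib]
          refine Finset.sum_congr rfl fun e _ => ?_
          rw [ctRowDefect, Finset.mul_sum, ← Finset.sum_add_distrib]
          exact Finset.sum_congr rfl fun e' _ => by ring
  have h3 : ∑ e, ‖z e‖ ^ 2 * ctRowDefect A κ ρ e ≤ J * nsq z := by
    rw [nsq, Finset.mul_sum]
    refine Finset.sum_le_sum fun e _ => ?_
    rw [mul_comm]; exact mul_le_mul_of_nonneg_right (hJ e) (sq_nonneg _)
  have h4 : -(∑ e, ∑ e', ‖z e‖ * ‖A e e'‖ * ‖z e'‖ * ctWeight κ ρ e e')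
      ≤ ∑ e, ∑ e', ((starRingEnd ℂ) (z e) * A e e' * z e').re * ctWeight κ ρ e e' := by
    rw [← Finset.sum_neg_distrib]
    refine Finset.sum_le_sum fun e _ => ?_
    rw [← Finset.sum_neg_distrib]
    exact Finset.sum_le_sum fun e' _ => h1 e e'
  rw [hsplit, hform]
  linarith

omit [DecidableEq ι] in
/-- **THE WEIGHTED-SOLUTION BOUND**: `A` Hermitian, `Coercive γ A`, row defects `≤ J < γ`; if `Ax = v` then
`(γ − J)·‖e^{κρ}x‖ ≤ ‖e^{κρ}v‖` (the engine of `Beta.DeltaACombesThomas.combesThomas_pairwise`, stated on its own). [folklore] -/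
theorem weighted_solution_bound (A : Matrix ι ι ℂ) (hA : A.IsHermitian) (κ : ℝ) (ρ : ι → ℝ) {γ J : ℝ} (hγ : Coercive γ A)
    (hJ : ∀ e, ctRowDefect A κ ρ e ≤ J) {x v : ι → ℂ} (hx : A *ᵥ x = v) :
    (γ - J) * Real.sqrt (nsq (wvec κ ρ x)) ≤ Real.sqrt (nsq (wvec κ ρ v)) := by
  set z := wvec κ ρ x with hz
  set w := wvec κ ρ v with hw
  have hcoer := conjugated_form_coercive A hA κ ρ hγ hJ z
  rw [hz, conj_form_eq_dot A κ ρ hx, ← hz, ← hw] at hcoer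
  have hCS : (star z ⬝ᵥ w).re ≤ Real.sqrt (nsq z) * Real.sqrt (nsq w) := (Complex.re_le_norm _).trans (norm_star_dotProduct_le z w)
  have hZ0 : 0 ≤ Real.sqrt (nsq z) := Real.sqrt_nonneg _
  by_cases hZ : Real.sqrt (nsq z) = 0
  · rw [hZ, mul_zero]; exact Real.sqrt_nonneg _
  · have hZpos : 0 < Real.sqrt (nsq z) := lt_of_le_of_ne hZ0 (Ne.symm hZ)
    have key : ((γ - J) * Real.sqrt (nsq z)) * Real.sqrt (nsq z) ≤ Real.sqrt (nsq w) * Real.sqrt (nsq z) := by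
      calc ((γ - J) * Real.sqrt (nsq z)) * Real.sqrt (nsq z) = (γ - J) * (Real.sqrt (nsq z) * Real.sqrt (nsq z)) := by ring
        _ = (γ - J) * nsq z := by rw [Real.mul_self_sqrt (nsq_nonneg _)]
        _ ≤ Real.sqrt (nsq z) * Real.sqrt (nsq w) := hcoer.trans hCS
        _ = Real.sqrt (nsq w) * Real.sqrt (nsq z) := mul_comm _ _
    exact le_of_mul_le_mul_right key hZpos

omit [DecidableEq ι] in
/-- **THE WEIGHTED-FORM BOUND**: under the same hypotheses, `Re⟨z, Az⟩ ≤ γ/(γ − J)²·‖e^{κρ}v‖²` for `z = e^{κρ}x`, `Ax = v`. [folklore] -/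
theorem weighted_form_bound (A : Matrix ι ι ℂ) (hA : A.IsHermitian) (κ : ℝ) (ρ : ι → ℝ) {γ J : ℝ} (hγ : Coercive γ A)
    (hJ : ∀ e, ctRowDefect A κ ρ e ≤ J) (hJ0 : 0 ≤ J) (hm : J < γ) {x v : ι → ℂ} (hx : A *ᵥ x = v) :
    (star (wvec κ ρ x) ⬝ᵥ (A *ᵥ wvec κ ρ x)).re ≤ γ / (γ - J) ^ 2 * nsq (wvec κ ρ v) := by
  set z := wvec κ ρ x with hz
  set w := wvec κ ρ v with hw
  have hm0 : 0 < γ - J := by linarith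
  have hsol : (γ - J) * Real.sqrt (nsq z) ≤ Real.sqrt (nsq w) := weighted_solution_bound A hA κ ρ hγ hJ hx
  have hZ : Real.sqrt (nsq z) ≤ Real.sqrt (nsq w) / (γ - J) := by rw [le_div_iff₀ hm0, mul_comm]; exact hsol
  have h1 := re_form_le_conj_add A hA κ ρ hJ z
  rw [hz, conj_form_eq_dot A κ ρ hx, ← hz, ← hw] at h1
  have hCS : (star z ⬝ᵥ w).re ≤ Real.sqrt (nsq z) * Real.sqrt (nsq w) := (Complex.re_le_norm _).trans (norm_star_dotProduct_le z w)
  set Z := Real.sqrt (nsq z) with hZdef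
  set W := Real.sqrt (nsq w) with hWdef
  have hW0 : 0 ≤ W := Real.sqrt_nonneg _
  have hZ0 : 0 ≤ Z := Real.sqrt_nonneg _
  have hnsqz : Z ^ 2 = nsq z := Real.sq_sqrt (nsq_nonneg _)
  have hnsqw : W ^ 2 = nsq w := Real.sq_sqrt (nsq_nonneg _)
  have hform : (star z ⬝ᵥ (A *ᵥ z)).re ≤ Z * W + J * Z ^ 2 := by rw [hnsqz]; linarith
  calc (star z ⬝ᵥ (A *ᵥ z)).re ≤ Z * W + J * Z ^ 2 := hform
    _ ≤ (W / (γ - J)) * W + J * (W / (γ - J)) ^ 2 := by gcongr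
    _ = γ / (γ - J) ^ 2 * W ^ 2 := by field_simp; ring
    _ = γ / (γ - J) ^ 2 * nsq w := by rw [hnsqw]

omit [DecidableEq ι] in
/-- **THE WEIGHTED GRAM BOUND**: for `A = XᴴX + Y` with `Y ⪰ 0`, `‖X·e^{κρ}A⁻¹v‖² ≤ γ/(γ − J)²·‖e^{κρ}v‖²`. [folklore] -/
theorem weighted_gram_bound {τ : Type*} [Fintype τ] {A Y : Matrix ι ι ℂ} {X : Matrix τ ι ℂ} (hAX : A = Xᴴ * X + Y) (hY : Y.PosSemidef)
    (hA : A.IsHermitian) (κ : ℝ) (ρ : ι → ℝ) {γ J : ℝ} (hγ : Coercive γ A) (hJ : ∀ e, ctRowDefect A κ ρ e ≤ J) (hJ0 : 0 ≤ J) (hm : J < γ)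
    {x v : ι → ℂ} (hx : A *ᵥ x = v) :
    nsq (X *ᵥ wvec κ ρ x) ≤ γ / (γ - J) ^ 2 * nsq (wvec κ ρ v) :=
  (nsq_le_re_form hAX hY _).trans (weighted_form_bound A hA κ ρ hγ hJ hJ0 hm hx)

omit [DecidableEq ι] in
/-- `⟨u, Mᴴv⟩ = conj ⟨v, Mu⟩`. [folklore] -/
theorem star_dotProduct_conjTranspose_mulVec {τ : Type*} [Fintype τ] (Mx : Matrix τ ι ℂ) (u : ι → ℂ) (v : τ → ℂ) :
    star u ⬝ᵥ (Mxᴴ *ᵥ v) = star (star v ⬝ᵥ (Mx *ᵥ u)) := by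
  simp only [dotProduct, Matrix.mulVec, Matrix.conjTranspose_apply, Pi.star_apply, star_sum, star_mul', star_star, Finset.mul_sum]
  rw [Finset.sum_comm]
  exact Finset.sum_congr rfl fun j _ => Finset.sum_congr rfl fun i _ => by ring

end Generic

end Summit.QuantumFields.BalabanUV.T4Continuum.ScalarCovariantCTWeighted

end
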